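import Summits.CriticalPhenomena.Ising3DConformalLimit.Theses.ArmHyperscaling
import Summits.CriticalPhenomena.Ising3DConformalLimit.Theorems.PerfectScreeningCoulombImpliesNontrivialIsothermOfOneArm
import Summits.CriticalPhenomena.Ising3DConformalLimit.Theorems.PerfectScreeningCoulombImpliesNontrivialOfOneArmHyperscaling
import Summits.CriticalPhenomena.Ising3DConformalLimit.Theorems.LeeYangGapGaussianLimitKillsBlockCouplingBlockSums
import Summits.CriticalPhenomena.Ising3DConformalLimit.Theorems.LeeYangGapGaussianLimitKillsBlockCouplingDoubling
import Literature.Probability.LatticeModels.CriticalBlockMoments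
import Literature.Probability.LatticeModels.PointwiseScalingLimitEtaExists
import HarnessLib

/-!
# One-arm hyperscaling saturates the matched upper critical isotherm (stub S4)

Crux `MergingFloor` (item stmt-CriticalPhenomena-15592, route ArmHyperscaling, Ising3DConformalLimit),
line `one-arm-isotherm-lattice`, registered stub `stub_oneArmGivesMatchedIsotherm` (S4); verbatim also
stub S4 of crux 0636, line `isotherm-saturation-lee-yang`.

Notation: `β = β_c(3)`, `Λ_L = box 3 L`, `V_L = (2L+1)³ = |Λ_L|`, `M_L = Σ_{x ∈ Λ_L} σ_x`,
`Σ_L = ⟨M_L²⟩_β = Σ_{a,b ∈ Λ_L} ⟨σ_aσ_b⟩_β` (`plusExpect_blockSpin_sq_eq_sum`), `G(z) = ⟨σ₀σ_z⟩_β`,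
`χ(N) = Σ_{z ∈ Λ_N} G(z)`, `a(N) = ⟨σ₀⟩⁺_{Λ_N;β,0}` (plus-box magnetisation at the centre).

**Statement.** `OneArmHyperscaling` (item 15591: `a(Kn)² ≤ C₀ G(2n e₀)`, `n ≥ 1`) implies, for every
non-degenerate scale-covariant pointwise scaling limit of `criticalCorr 3` with renormalisation `ρ > 0`
on `(0,1]`, a constant `C > 0` with, for all large `L` and the matched field `h_L = C/√Σ_L`,
`V_L · m(β, h_L) ≤ (β C / 2) √Σ_L`.

**Proof.**
1. GHS tangent line in the plus box `Λ_N` (`mag_le_boxMag_add`): `m(β,h) ≤ a(N) + β χ(N) h`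
   (`plusCorr_le_isingCorr_plus_box`, `boxMag_le_zeroField_add_field_mul`,
   `isingTrunc_plus_box_le_plusExpect`, `m*(β_c) = 0`).
2. Field term. The doubling lemma `exists_eta_boxSum_floor_le` (`ε = 1/108`) gives `η ∈ (0,1]` with
   `χ(⌊ηL⌋) ≤ χ(L/2)/108` eventually; with `N = K⌊(η/K)L⌋ ≤ ⌊ηL⌋`, `V_L ≤ 27 |Λ_{L/2}|` and
   `|Λ_{L/2}| χ(L/2) ≤ Σ_L` (`card_mul_boxSum_le_blockSum`): `V_L χ(N) ≤ Σ_L / 4`, so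
   `β h_L V_L χ(N) ≤ (βC/4) √Σ_L`.
3. Boundary term. One-arm: `a(N)² ≤ C₀ G(2n e₀)`, `n = ⌊tL⌋`, `t = η/K`; axis antitonicity (MMS) and the
   scaling limit read at the lattice pairs `(0, ⌊tL⌋ e₀)` and `(0, 2L e₀)` give `G(2n e₀) ≤ R G(2L e₀)`
   eventually (`eventually_axis_ratio`), and `|Λ_{L/2}|² G(2L e₀) ≤ Σ_L` (`card_sq_mul_axis_le_blockSum`),
   so `(V_L a(N))² ≤ 729 C₀⁺ R Σ_L =: A Σ_L`.
4. Choose `C = 4(√A + 1)/β`, so `(βC/4)² ≥ A`: then `V_L a(N) ≤ (βC/4)√Σ_L` and the sum is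
   `≤ (βC/2) √Σ_L` (`matched_arith`).
-/

noncomputable section

namespace Summit.CriticalPhenomena.Ising3DConformalLimit.ArmHyperscalingMergingFloor

open Literature.Probability.LatticeModels Filter Set Finset
open scoped Topology BigOperators
open Summit.CriticalPhenomena.Ising3DConformalLimit.PerfectScreeningCoulombImpliesNontrivial
open Summit.CriticalPhenomena.Ising3DConformalLimit.LeeYangGapGaussianLimitKillsBlockCoupling

/-! ### Step 1: the GHS tangent line in a plus box -/

/-- **Per-box GHS bound at `β_c`**: for `h ≥ 0` and every `N`,
`m(β_c,h) ≤ ⟨σ₀⟩⁺_{Λ_N;β_c,0} + β_c χ(N) h` (plus boxes decrease to the plus state; GHS tangent line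
`boxMag_le_zeroField_add_field_mul`; GHS volume monotonicity `⟨σ₀;σ_y⟩⁺_{Λ_N;β_c,0} ≤ ⟨σ₀σ_y⟩_{β_c}`
with `m*(β_c) = 0`). Steps h1–h4 of `magnetizationInField_le_of_oneArm_box`. -/
theorem mag_le_boxMag_add {h : ℝ} (hh : 0 ≤ h) (N : ℕ) :
    magnetizationInField 3 (criticalBeta 3) h ≤
      isingExpect (zdGraph 3) (box 3 N) (criticalBeta 3) 0 .plus (spinAt 0) +
        criticalBeta 3 * (∑ z ∈ box 3 N, criticalTwoPoint 3 z) * h := by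
  have hβ : 0 < criticalBeta 3 := criticalBeta_pos_holds (d := 3) (by norm_num)
  -- `m(h) ≤ ⟨σ₀⟩⁺_{box N, h}`
  have h1 : magnetizationInField 3 (criticalBeta 3) h ≤
      isingExpect (zdGraph 3) (box 3 N) (criticalBeta 3) h .plus (spinAt 0) := by
    have hle := plusCorr_le_isingCorr_plus_box (d := 3) hβ.le hh
      (A := {0}) (L := N) (Finset.singleton_subset_iff.2 (zero_mem_box 3 N))
    rw [magnetizationInField_eq_plusCorr]
    refine hle.trans_eq ?_
    simp only [isingCorr]
    congr 1
    funext σ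
    simp [spinProduct]
  -- the truncated plus-box two-point functions at `h = 0` are bounded by `G(y)`
  have hm0 : plusExpect 3 (criticalBeta 3) 0 (spinAt 0) = 0 :=
    spontaneousMagnetization_criticalBeta_eq_zero_holds (d := 3) (by norm_num)
  have h2 : ∀ y ∈ box 3 N,
      isingExpect (zdGraph 3) (box 3 N) (criticalBeta 3) 0 .plus (fun σ => spinAt 0 σ * spinAt y σ) -
          isingExpect (zdGraph 3) (box 3 N) (criticalBeta 3) 0 .plus (spinAt 0) *
            isingExpect (zdGraph 3) (box 3 N) (criticalBeta 3) 0 .plus (spinAt y) ≤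
        criticalTwoPoint 3 y := by
    intro y hy
    have hle := isingTrunc_plus_box_le_plusExpect (d := 3) hβ.le le_rfl (zero_mem_box 3 N) hy
    refine hle.trans ?_
    rw [hm0, zero_mul, sub_zero]
    exact le_of_eq rfl
  have h3 := Finset.sum_le_sum h2
  have h4 := boxMag_le_zeroField_add_field_mul (d := 3) hβ.le hh N
  calc magnetizationInField 3 (criticalBeta 3) h
      ≤ isingExpect (zdGraph 3) (box 3 N) (criticalBeta 3) h .plus (spinAt 0) := h1
    _ ≤ _ := h4
    _ ≤ isingExpect (zdGraph 3) (box 3 N) (criticalBeta 3) 0 .plus (spinAt 0) +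
        criticalBeta 3 * (∑ z ∈ box 3 N, criticalTwoPoint 3 z) * h :=
        add_le_add le_rfl (mul_le_mul_of_nonneg_right (mul_le_mul_of_nonneg_left h3 hβ.le) hh)

/-- `⟨σ₀⟩⁺_{Λ_N;β_c,0} ≥ 0` (first Griffiths inequality in the plus box). [cite: FriedliVelenik2017, Thm. 3.20, eq. (3.21), p. 109] -/
theorem boxMag_nonneg (N : ℕ) :
    0 ≤ isingExpect (zdGraph 3) (box 3 N) (criticalBeta 3) 0 .plus (spinAt 0) := by
  have := GKSInequalities.gks_one_holds (zdGraph 3) (Λ := box 3 N) (A := ({0} : Finset (Site 3)))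
    (β := criticalBeta 3) (h := 0) (bc := .plus) (criticalBeta_nonneg 3)
    le_rfl (Or.inr rfl) (Finset.singleton_subset_iff.2 (zero_mem_box 3 N))
  simpa [isingCorr] using this

/-! ### Step 3: the scaling limit at the lattice pair `(0, ⌊tL⌋ e₀)` and the axis ratio -/

/-- At mesh `1/L` the pair `(0, t e₀)` of `ℝ³`, `t ≥ 0`, sits on the lattice pair `(0, ⌊tL⌋ e₀)`. -/
theorem latticeApprox_inv_natCast_unitVec {t : ℝ} (ht : 0 ≤ t) (L : ℕ) :
    (fun i => latticeApprox (1 / (L : ℝ))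
        ((![0, EuclideanSpace.single (0 : Fin 3) t] : Fin 2 → EuclideanSpace ℝ (Fin 3)) i)) =
      ![(0 : Site 3), Pi.single 0 ((⌊t * L⌋₊ : ℕ) : ℤ)] := by
  funext i j
  fin_cases i
  · simp [latticeApprox_apply]
  · simp only [latticeApprox_apply, Fin.mk_one, Matrix.cons_val_one, Matrix.cons_val_zero,
      PiLp.single_apply, Pi.single_apply]
    by_cases hj : j = 0
    · subst hj
      simp only [if_true]
      rw [Int.natCast_floor_eq_floor (by positivity), one_div, div_inv_eq_mul]
    · simp [hj]

/-- **`ρ(1/L)² ⟨σ₀σ_{⌊tL⌋ e₀}⟩_{β_c} → S₂(0, t e₀)`** along the integer meshes `δ = 1/L`, for a pointwise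
scaling limit `S` of `criticalCorr 3` with renormalisation `ρ` and `t > 0` (pattern of
`tendsto_renorm_sq_mul_axis_two`). -/
theorem tendsto_renorm_sq_mul_axis_floor {ρ : ℝ → ℝ} {S : CorrFamily 3}
    (hlim : HasPointwiseScalingLimit (criticalCorr 3) ρ S) {t : ℝ} (ht : 0 < t) :
    Tendsto (fun L : ℕ => ρ (1 / (L : ℝ)) ^ 2 * criticalTwoPoint 3 (Pi.single 0 ((⌊t * L⌋₊ : ℕ) : ℤ)))
      atTop (𝓝 (S 2 ![0, EuclideanSpace.single (0 : Fin 3) t])) := by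
  have hδ : Tendsto (fun L : ℕ => (1 : ℝ) / L) atTop (𝓝[>] (0 : ℝ)) := by
    refine tendsto_nhdsWithin_iff.2 ⟨tendsto_one_div_atTop_nhds_zero_nat, ?_⟩
    filter_upwards [eventually_ge_atTop 1] with L hL
    have hL' : (0 : ℝ) < L := Nat.cast_pos.2 hL
    exact one_div_pos.2 hL'
  have hx₀ := zero_unitVec_mem_nonCoincident (t := t) ht.ne'
  have h1 := ((hlim 2).tendsto_at hx₀).comp hδ
  refine h1.congr fun L => ?_
  simp only [Function.comp_apply, rescaledCorrelator_apply]
  rw [latticeApprox_inv_natCast_unitVec ht.le L, criticalCorr_two]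

/-- **Axis ratio from the scaling limit**: for `t > 0` there is `R ≥ 0` with
`⟨σ₀σ_{2⌊tL⌋ e₀}⟩_{β_c} ≤ R ⟨σ₀σ_{2L e₀}⟩_{β_c}` for all large `L` (Messager–Miracle-Solé axis antitonicity
`G(2n e₀) ≤ G(n e₀)`, and the two limits `ρ(1/L)² G(⌊tL⌋ e₀) → S₂(0,te₀)`, `ρ(1/L)² G(2L e₀) → S₂(0,2e₀) > 0`;
`R = 4 S₂(0,te₀)/S₂(0,2e₀)`). -/
theorem eventually_axis_ratio {ρ : ℝ → ℝ} {S : CorrFamily 3}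
    (hρ : ∀ δ ∈ Set.Ioc (0:ℝ) 1, 0 < ρ δ)
    (hlim : HasPointwiseScalingLimit (criticalCorr 3) ρ S) (hnd : IsNondegenerateTwoPoint S)
    {t : ℝ} (ht : 0 < t) :
    ∃ R : ℝ, 0 ≤ R ∧ ∀ᶠ L : ℕ in atTop,
      criticalTwoPoint 3 (Pi.single 0 (2 * ((⌊t * L⌋₊ : ℕ) : ℤ))) ≤
        R * criticalTwoPoint 3 (Pi.single 0 ((2 * L : ℕ) : ℤ)) := by
  obtain ⟨st, hst⟩ : ∃ st : ℝ, S 2 ![0, EuclideanSpace.single (0 : Fin 3) t] = st := ⟨_, rfl⟩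
  obtain ⟨s₂, hs₂⟩ : ∃ s₂ : ℝ, S 2 ![0, EuclideanSpace.single (0 : Fin 3) ((2 : ℕ) : ℝ)] = s₂ :=
    ⟨_, rfl⟩
  have hst0 : 0 < st := hst ▸ hnd _ (zero_unitVec_mem_nonCoincident ht.ne')
  have hs₂0 : 0 < s₂ := hs₂ ▸ hnd _ (zero_unitVec_mem_nonCoincident (by norm_num))
  have hT1 := tendsto_renorm_sq_mul_axis_floor hlim ht
  have hT2 := tendsto_renorm_sq_mul_axis_two hlim
  rw [hst] at hT1
  rw [hs₂] at hT2
  have hev1 := hT1.eventually_lt_const (show st < 2 * st by linarith)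
  have hev2 := hT2.eventually_const_lt (show s₂ / 2 < s₂ by linarith)
  refine ⟨4 * st / s₂, by positivity, ?_⟩
  filter_upwards [hev1, hev2, eventually_ge_atTop 1] with L h1 h2 hL
  have hL' : (0 : ℝ) < L := Nat.cast_pos.2 hL
  have hP : 0 < ρ (1 / (L : ℝ)) ^ 2 := by
    refine pow_pos (hρ _ ⟨one_div_pos.2 hL', ?_⟩) 2
    rw [div_le_one hL']
    exact_mod_cast hL
  have hanti : criticalTwoPoint 3 (Pi.single 0 (2 * ((⌊t * L⌋₊ : ℕ) : ℤ))) ≤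
      criticalTwoPoint 3 (Pi.single 0 ((⌊t * L⌋₊ : ℕ) : ℤ)) := by
    have h := criticalTwoPoint_axis_antitone (show ⌊t * L⌋₊ ≤ 2 * ⌊t * L⌋₊ by omega)
    dsimp only at h
    rwa [Nat.cast_mul, Nat.cast_ofNat] at h
  refine le_of_mul_le_mul_left ?_ hP
  calc ρ (1 / (L : ℝ)) ^ 2 * criticalTwoPoint 3 (Pi.single 0 (2 * ((⌊t * L⌋₊ : ℕ) : ℤ)))
      ≤ ρ (1 / (L : ℝ)) ^ 2 * criticalTwoPoint 3 (Pi.single 0 ((⌊t * L⌋₊ : ℕ) : ℤ)) :=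
        mul_le_mul_of_nonneg_left hanti hP.le
    _ ≤ 2 * st := h1.le
    _ = 4 * st / s₂ * (s₂ / 2) := by field_simp; ring
    _ ≤ 4 * st / s₂ * (ρ (1 / (L : ℝ)) ^ 2 * criticalTwoPoint 3 (Pi.single 0 ((2 * L : ℕ) : ℤ))) :=
        mul_le_mul_of_nonneg_left h2.le (by positivity)
    _ = ρ (1 / (L : ℝ)) ^ 2 * (4 * st / s₂ * criticalTwoPoint 3 (Pi.single 0 ((2 * L : ℕ) : ℤ))) := by
        ring

/-! ### Step 4: the real arithmetic of the assembly -/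

/-- **Assembly arithmetic.** With `s = √Sg`, `h = C/s`: from `m ≤ a + β χ h`, `V χ ≤ Sg/4`,
`(V a)² ≤ A Sg` and `β C/4 = √A + 1` (so `(βC/4)² ≥ A`), `V m ≤ (βC/2) s`. -/
theorem matched_arith {β C Sg V a χ m A : ℝ} (hβ : 0 < β) (hC : 0 < C) (hSg : 0 < Sg) (hV : 0 ≤ V)
    (hA : 0 ≤ A) (hβC : β * C / 4 = Real.sqrt A + 1)
    (hmag : m ≤ a + β * χ * (C / Real.sqrt Sg))
    (hfield : V * χ ≤ Sg / 4) (hbdry : (V * a) ^ 2 ≤ A * Sg) :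
    V * m ≤ β * C / 2 * Real.sqrt Sg := by
  obtain ⟨s, hs⟩ : ∃ s : ℝ, Real.sqrt Sg = s := ⟨_, rfl⟩
  have hs0 : 0 < s := hs ▸ Real.sqrt_pos.2 hSg
  have hs2 : s ^ 2 = Sg := by rw [← hs, Real.sq_sqrt hSg.le]
  rw [hs] at hmag ⊢
  -- boundary term: `V a ≤ (βC/4) s`
  have hB : V * a ≤ β * C / 4 * s := by
    refine le_of_sq_le_sq ?_ (by positivity)
    rw [mul_pow (β * C / 4), hs2, hβC]
    calc (V * a) ^ 2 ≤ A * Sg := hbdry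
      _ ≤ (Real.sqrt A + 1) ^ 2 * Sg := by
          refine mul_le_mul_of_nonneg_right ?_ hSg.le
          have hsA := Real.sq_sqrt hA
          nlinarith [Real.sqrt_nonneg A]
  -- field term: `V β χ (C/s) ≤ (βC/4) s`
  have hF : V * (β * χ * (C / s)) ≤ β * C / 4 * s := by
    have h1 : V * (β * χ * (C / s)) = β * C * (V * χ) / s := by ring
    rw [h1, div_le_iff₀ hs0]
    calc β * C * (V * χ) ≤ β * C * (Sg / 4) := mul_le_mul_of_nonneg_left hfield (by positivity)
      _ = β * C / 4 * s * s := by rw [← hs2]; ring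
  calc V * m ≤ V * (a + β * χ * (C / s)) := mul_le_mul_of_nonneg_left hmag hV
    _ = V * a + V * (β * χ * (C / s)) := by ring
    _ ≤ β * C / 4 * s + β * C / 4 * s := add_le_add hB hF
    _ = β * C / 2 * s := by ring

/-! ### The stub -/

/-- **S4 — ONE-ARM HYPERSCALING SATURATES THE MATCHED ISOTHERM.** `OneArmHyperscaling` (item
stmt-CriticalPhenomena-15591) implies: for every pointwise scaling limit `S` of `criticalCorr 3` with
renormalisation `ρ > 0` on `(0,1]`, non-degenerate two-point function and scale covariance, there is
`C > 0` such that for all large `L`, at the matched field `h_L = C/√Σ_L`,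
`(2L+1)³ · m(β_c, h_L) ≤ (β_c C/2) · √Σ_L`. GHS tangent line in the plus box `Λ_{K⌊(η/K)L⌋}`
(`mag_le_boxMag_add`), the doubling lemma `exists_eta_boxSum_floor_le` with `card_mul_boxSum_le_blockSum`
(field term), and the one-arm bound with `card_sq_mul_axis_le_blockSum`, MMS axis antitonicity and the
limits at `(0, (η/K)e₀)`, `(0, 2e₀)` (boundary term, `eventually_axis_ratio`); then `C = 4(√A+1)/β_c`.
[cite: CamiaGarbanNewman2016, Thm 1.2] -/
theorem stub_oneArmGivesMatchedIsotherm :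
    Summit.CriticalPhenomena.Ising3DConformalLimit.Theses.ArmHyperscaling.OneArmHyperscaling →
    ∀ (ρ : ℝ → ℝ) (Δ : ℝ) (S : CorrFamily 3), (∀ δ ∈ Set.Ioc (0:ℝ) 1, 0 < ρ δ) →
      HasPointwiseScalingLimit (criticalCorr 3) ρ S → IsNondegenerateTwoPoint S →
      IsScaleCovariant Δ S →
      ∃ C : ℝ, 0 < C ∧ ∀ᶠ L : ℕ in atTop,
        (2 * (L : ℝ) + 1) ^ 3 * magnetizationInField 3 (criticalBeta 3)
            (C / Real.sqrt (plusExpect 3 (criticalBeta 3) 0 (fun σ => (∑ x ∈ box 3 L, spinAt x σ) ^ 2))) ≤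
          criticalBeta 3 * C / 2 *
            Real.sqrt (plusExpect 3 (criticalBeta 3) 0 (fun σ => (∑ x ∈ box 3 L, spinAt x σ) ^ 2)) := by
  rintro ⟨K, hK, C₀, hOA⟩ ρ Δ S hρ hlim hnd hsc
  have hβ : 0 < criticalBeta 3 := criticalBeta_pos_holds (d := 3) (by norm_num)
  -- the doubling lemma with `ε = 1/108`, the ratio `t = η/K`, and the axis ratio `R`
  obtain ⟨η, hη0, -, hdbl⟩ :=
    exists_eta_boxSum_floor_le hρ hlim hnd hsc (ε := 1 / 108) (by norm_num)
  have hKpos : (0 : ℝ) < K := by exact_mod_cast hK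
  obtain ⟨t, ht⟩ : ∃ t : ℝ, η / K = t := ⟨_, rfl⟩
  have ht0 : 0 < t := ht ▸ div_pos hη0 hKpos
  have hηt : (K : ℝ) * t = η := by rw [← ht]; field_simp
  obtain ⟨R, hR0, hratio⟩ := eventually_axis_ratio hρ hlim hnd ht0
  -- constants
  have hC₁0 : 0 ≤ max C₀ 0 := le_max_right _ _
  obtain ⟨A, hA⟩ : ∃ A : ℝ, 729 * max C₀ 0 * R = A := ⟨_, rfl⟩
  have hA0 : 0 ≤ A := hA ▸ by positivity
  refine ⟨4 * (Real.sqrt A + 1) / criticalBeta 3, by positivity, ?_⟩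
  have hβC : criticalBeta 3 * (4 * (Real.sqrt A + 1) / criticalBeta 3) / 4 = Real.sqrt A + 1 := by
    field_simp
  filter_upwards [hdbl, hratio, eventually_ge_atTop ⌈1 / t⌉₊, eventually_ge_atTop 1]
    with L hdL hrL hLt hL1
  -- the scales `n = ⌊tL⌋ ≥ 1` and `N = K n ≤ ⌊ηL⌋`
  have hn1 : 1 ≤ ⌊t * L⌋₊ := by
    have h2 : 1 / t ≤ (L : ℝ) := (Nat.le_ceil _).trans (by exact_mod_cast hLt)
    have h3 : (1 : ℝ) ≤ t * L := by rw [mul_comm]; exact (div_le_iff₀ ht0).1 h2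
    exact Nat.succ_le_of_lt (Nat.floor_pos.2 h3)
  have hNle : K * ⌊t * L⌋₊ ≤ ⌊η * L⌋₊ := by
    refine Nat.le_floor ?_
    have h1 : (⌊t * L⌋₊ : ℝ) ≤ t * L := Nat.floor_le (by positivity)
    calc ((K * ⌊t * L⌋₊ : ℕ) : ℝ) = K * (⌊t * L⌋₊ : ℝ) := by push_cast; ring
      _ ≤ K * (t * L) := mul_le_mul_of_nonneg_left h1 hKpos.le
      _ = η * L := by rw [← hηt]; ring
  -- the block variance `Σ_L > 0` and its two-point expansion
  have hSg : 0 < plusExpect 3 (criticalBeta 3) 0 (fun σ => (∑ x ∈ box 3 L, spinAt x σ) ^ 2) :=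
    sketchPub_blockVariance_pos L
  have hSg_eq := plusExpect_blockSpin_sq_eq_sum 3 L
  -- Step 1 at the matched field, in the box `Λ_{K n}`
  have hmag := mag_le_boxMag_add (N := K * ⌊t * L⌋₊) (h := 4 * (Real.sqrt A + 1) / criticalBeta 3 /
    Real.sqrt (plusExpect 3 (criticalBeta 3) 0 (fun σ => (∑ x ∈ box 3 L, spinAt x σ) ^ 2)))
    (by positivity)
  -- volumes: `V_L ≤ 27 |Λ_{L/2}|`
  have hVH : (2 * (L : ℝ) + 1) ^ 3 ≤ 27 * (#(box 3 (L / 2)) : ℝ) := by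
    have h1 : (2 * (L : ℝ) + 1) ^ 3 = (#(box 3 L) : ℝ) := by
      rw [card_box]; push_cast; ring
    rw [h1]
    exact (card_box_le L hL1).trans
      (mul_le_mul_of_nonneg_left (pow_three_le_card_box_half L) (by norm_num))
  have hV0 : (0 : ℝ) ≤ (2 * (L : ℝ) + 1) ^ 3 := by positivity
  -- Step 2, field term: `V_L χ(N) ≤ Σ_L / 4`
  have hfield : (2 * (L : ℝ) + 1) ^ 3 * (∑ z ∈ box 3 (K * ⌊t * L⌋₊), criticalTwoPoint 3 z) ≤
      plusExpect 3 (criticalBeta 3) 0 (fun σ => (∑ x ∈ box 3 L, spinAt x σ) ^ 2) / 4 := by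
    have h1 : ∑ z ∈ box 3 (K * ⌊t * L⌋₊), criticalTwoPoint 3 z ≤
        1 / 108 * ∑ z ∈ box 3 (L / 2), criticalTwoPoint 3 z := (boxSum_mono hNle).trans hdL
    have h2 : (#(box 3 (L / 2)) : ℝ) * ∑ z ∈ box 3 (L / 2), criticalTwoPoint 3 z ≤
        plusExpect 3 (criticalBeta 3) 0 (fun σ => (∑ x ∈ box 3 L, spinAt x σ) ^ 2) := by
      rw [hSg_eq]; exact card_mul_boxSum_le_blockSum (d := 3) L
    have hχ0 : 0 ≤ ∑ z ∈ box 3 (L / 2), criticalTwoPoint 3 z := boxSum_nonneg _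
    calc (2 * (L : ℝ) + 1) ^ 3 * (∑ z ∈ box 3 (K * ⌊t * L⌋₊), criticalTwoPoint 3 z)
        ≤ (27 * (#(box 3 (L / 2)) : ℝ)) * (1 / 108 * ∑ z ∈ box 3 (L / 2), criticalTwoPoint 3 z) :=
          mul_le_mul hVH h1 (boxSum_nonneg _) (by positivity)
      _ = ((#(box 3 (L / 2)) : ℝ) * ∑ z ∈ box 3 (L / 2), criticalTwoPoint 3 z) / 4 := by ring
      _ ≤ _ := by linarith
  -- Step 3, boundary term: `(V_L a(N))² ≤ A Σ_L`
  have hbdry : ((2 * (L : ℝ) + 1) ^ 3 *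
      isingExpect (zdGraph 3) (box 3 (K * ⌊t * L⌋₊)) (criticalBeta 3) 0 .plus (spinAt 0)) ^ 2 ≤
      A * plusExpect 3 (criticalBeta 3) 0 (fun σ => (∑ x ∈ box 3 L, spinAt x σ) ^ 2) := by
    have h1 : isingExpect (zdGraph 3) (box 3 (K * ⌊t * L⌋₊)) (criticalBeta 3) 0 .plus (spinAt 0) ^ 2 ≤
        max C₀ 0 * criticalTwoPoint 3 (Pi.single 0 (2 * ((⌊t * L⌋₊ : ℕ) : ℤ))) := by
      have h := hOA _ hn1
      have ha_corr : isingCorr (zdGraph 3) (box 3 (K * ⌊t * L⌋₊)) (criticalBeta 3) 0 .plus {0} =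
          isingExpect (zdGraph 3) (box 3 (K * ⌊t * L⌋₊)) (criticalBeta 3) 0 .plus (spinAt 0) := by
        simp [isingCorr]
      rw [ha_corr] at h
      exact h.trans (mul_le_mul_of_nonneg_right (le_max_left _ _) (criticalTwoPoint_nonneg' _))
    have h3 : (#(box 3 (L / 2)) : ℝ) ^ 2 * criticalTwoPoint 3 (Pi.single 0 ((2 * L : ℕ) : ℤ)) ≤
        plusExpect 3 (criticalBeta 3) 0 (fun σ => (∑ x ∈ box 3 L, spinAt x σ) ^ 2) := by
      rw [hSg_eq]; exact card_sq_mul_axis_le_blockSum L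
    have hG0 : 0 ≤ criticalTwoPoint 3 (Pi.single 0 ((2 * L : ℕ) : ℤ)) := criticalTwoPoint_nonneg' _
    have ha0 := boxMag_nonneg (K * ⌊t * L⌋₊)
    have hV2 : ((2 * (L : ℝ) + 1) ^ 3) ^ 2 ≤ 729 * (#(box 3 (L / 2)) : ℝ) ^ 2 := by nlinarith
    calc ((2 * (L : ℝ) + 1) ^ 3 *
          isingExpect (zdGraph 3) (box 3 (K * ⌊t * L⌋₊)) (criticalBeta 3) 0 .plus (spinAt 0)) ^ 2
        = ((2 * (L : ℝ) + 1) ^ 3) ^ 2 *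
          isingExpect (zdGraph 3) (box 3 (K * ⌊t * L⌋₊)) (criticalBeta 3) 0 .plus (spinAt 0) ^ 2 := by
          ring
      _ ≤ (729 * (#(box 3 (L / 2)) : ℝ) ^ 2) *
          (max C₀ 0 * (R * criticalTwoPoint 3 (Pi.single 0 ((2 * L : ℕ) : ℤ)))) :=
          mul_le_mul hV2 (h1.trans (mul_le_mul_of_nonneg_left hrL hC₁0)) (by positivity)
            (by positivity)
      _ = A * ((#(box 3 (L / 2)) : ℝ) ^ 2 * criticalTwoPoint 3 (Pi.single 0 ((2 * L : ℕ) : ℤ))) := by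
          rw [← hA]; ring
      _ ≤ _ := mul_le_mul_of_nonneg_left h3 hA0
  -- Step 4: assembly
  exact matched_arith hβ (by positivity) hSg hV0 hA0 hβC hmag hfield hbdry

end Summit.CriticalPhenomena.Ising3DConformalLimit.ArmHyperscalingMergingFloor

end
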